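import Literature.NumberTheory.Sieve.DrappeauTopacogullariProofs
import HarnessLib

/-!
# Drappeau–Topacogullari 2019, §8 at conductor one, part A: `S = M̃ + E`, dyadic pieces, and `M̃ = M_f + M⁽²⁾ + O(·)`

Third file of the Drappeau–Topacogullari cluster (`…DrappeauTopacogullari` vendors Theorem 1.2 at
`D = 1` as the named fact `thm12_conductorOne` and the objects `τ̃_h(n; R)`, `Δ_h`, `Σ_f` of §2.1;
`…DrappeauTopacogullariProofs` proves the elementary bricks of §2.1).  This file formalizes, with
complete proofs, the ELEMENTARY part of the deduction of Theorem 1.2 from Proposition 2.1 and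
Lemma 8.1 printed in §8 (S. Drappeau, B. Topacogullari, Algebra & Number Theory 13 (2019), p. 23
of arXiv:1807.09569; held, `lit read arxiv-1807.09569`), at `D = 1`:

> "We start by splitting the sum `D_f(x; a, h)` into two parts … `D_f(√x; a, h) + ∑_{√x < n ≤ x}
> f(n) τ(an − h)`. While the first sum can be estimated by trivial means, we can use Proposition 2.1
> to evaluate the second (after first dividing the range of summation into dyadic intervals) … with
> `M̃_f(x; a, h) := ∑_{|h|/a < n ≤ x} f(n) τ̃_h(an; R)`. … After expanding `τ̃_h(an; R)`, it can be
> written as `M̃_f(x; a, h) = 2 ∑_{q ≤ √(ax)} φ(q/(h,q))⁻¹ ∑_{χ mod q/(h,q), cond χ ≤ R} χ̄(h/(h,q))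
> ∑_{q²/a ≤ n ≤ x, (an,q) = (h,q)} f(n) χ(an/(h,q)) + O(x^{δ+ε})`. We now split the remaining sum
> into two parts … depending on whether `cond(χ) ∣ D` or not. A simple reordering of the sums
> shows that the first part is equal to `M_f(x; a, h)`."

Contents (all PROVED; the only definitions are the three bookkeeping `Finset` expressions
`charSet`, `expandedSum`, `innerSet`, no named facts, D-0026):
* `shiftedSum_eq_dtilde_add_delta` (`S = M̃ + E`), `sum_filter_delta_eq_sigmaF` (the `Δ`-part
  beyond `√x` is `Σ_f((√x, x])`), `sigmaF_add`, `norm_sigmaF_le_of_dyadic` (dyadic pieces);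
* `sum_mul_dtilde_eq_expandedSum` (swap of the `n`- and `q`-sums), `expandedSum_eq_principal_add`
  + `mainTermOne_eq` (the principal character gives `M_f(x; h, a)` EXACTLY),
  `norm_expandedSum_sub_le` + `card_sdiff_add_card_sdiff_le` (each range adjustment changes at most
  `2|h|` indices `n` per `q`: `n ↦ an` injects them into an integer interval of length `|h|`),
  `sum_totient_inv_mul_card_charSet_le` (the weights, as in (2.2)), assembled in
  `norm_mtilde_sub_mainTermOne_sub_nonprincipal_le`:
  `|M̃ − M_f(x; h, a) − M⁽²⁾| ≤ 4B|h| · R|h|T²(1 + log Q)` with `B ≥ |f|` on `[1, x]`, `T ≥ τ` on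
  `[1, Q]`, `Q = max(⌊√(a⌊x⌋ + |h|)⌋, ⌊√(ax)⌋)` — i.e. `O(R x^{2δ+ε})` once `|f|, τ ≪ x^ε`.

Not here (part B, to come): the bound for the non-principal sum `M⁽²⁾` from Lemma 8.1 (the
reparametrisation `t = (a, (h,q))`, `n = u n₁` and the sums `S_{f,χ}(x, u)` of p. 23), the trivial
region `n ≤ √x`, and the final assembly of Theorem 1.2 at `D = 1` from Proposition 2.1 and
Lemma 8.1 as explicit hypotheses.

## References

* S. Drappeau, B. Topacogullari, *Combinatorial identities and Titchmarsh's divisor problem for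
  multiplicative functions*, Algebra Number Theory 13 (2019) 2383–2425, §8 (p. 23 of
  arXiv:1807.09569). [DrappeauTopacogullari2019]
-/

noncomputable section

open scoped ArithmeticFunction.zeta ArithmeticFunction.sigma ArithmeticFunction.Moebius
open ArithmeticFunction Finset Real

namespace Literature.NumberTheory.Sieve

namespace DrappeauTopacogullari2019

/-! ### Dyadic decomposition of `Σ_f` (p. 23: "after first dividing the range of summation into dyadic intervals") -/

/-- `Σ_f((y, y]; a, h; R) = 0` (empty interval). [cite: DrappeauTopacogullari2019, §2.1 (definition of Σ_f), p. 9] -/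
theorem sigmaF_self (f : ArithmeticFunction ℂ) (y : ℝ) (a : ℕ) (h : ℤ) (R : ℝ) :
    sigmaF f y y a h R = 0 := by
  unfold sigmaF
  refine Finset.sum_eq_zero fun n hn => ?_
  exfalso
  simp only [Finset.mem_filter, Finset.mem_Icc] at hn
  obtain ⟨⟨hn1, hny⟩, hyn⟩ := hn
  have hy0 : 0 ≤ y := by
    by_contra hneg
    push Not at hneg
    rw [Nat.floor_of_nonpos hneg.le] at hny
    omega
  have : (n : ℝ) ≤ y := (Nat.le_floor_iff hy0).mp hny
  linarith

/-- Additivity of `Σ_f` over adjacent intervals: `Σ_f((y₁, y₃]) = Σ_f((y₁, y₂]) + Σ_f((y₂, y₃])`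
for `y₁ ≤ y₂ ≤ y₃`, `y₂ ≥ 0`. [folklore] -/
theorem sigmaF_add (f : ArithmeticFunction ℂ) {y₁ y₂ y₃ : ℝ} (h0 : 0 ≤ y₂) (h12 : y₁ ≤ y₂)
    (h23 : y₂ ≤ y₃) (a : ℕ) (h : ℤ) (R : ℝ) :
    sigmaF f y₁ y₃ a h R = sigmaF f y₁ y₂ a h R + sigmaF f y₂ y₃ a h R := by
  unfold sigmaF
  rw [← Finset.sum_filter_add_sum_filter_not
    ((Finset.Icc 1 ⌊y₃⌋₊).filter (fun n : ℕ => y₁ < (n : ℝ))) (fun n : ℕ => (n : ℝ) ≤ y₂)]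
  congr 1
  · refine Finset.sum_congr ?_ (fun _ _ => rfl)
    ext n
    simp only [Finset.mem_filter, Finset.mem_Icc]
    constructor
    · rintro ⟨⟨⟨h1, -⟩, hy1⟩, hy2⟩
      exact ⟨⟨h1, (Nat.le_floor_iff h0).mpr hy2⟩, hy1⟩
    · rintro ⟨⟨h1, h2⟩, hy1⟩
      have hy2 : (n : ℝ) ≤ y₂ := (Nat.le_floor_iff h0).mp h2
      exact ⟨⟨⟨h1, (Nat.le_floor_iff (h0.trans h23)).mpr (hy2.trans h23)⟩, hy1⟩, hy2⟩
  · refine Finset.sum_congr ?_ (fun _ _ => rfl)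
    ext n
    simp only [Finset.mem_filter, Finset.mem_Icc, not_le]
    constructor
    · rintro ⟨⟨⟨h1, h3⟩, -⟩, hy2⟩
      exact ⟨⟨h1, h3⟩, hy2⟩
    · rintro ⟨⟨h1, h3⟩, hy2⟩
      exact ⟨⟨⟨h1, h3⟩, lt_of_le_of_lt h12 hy2⟩, hy2⟩

/-- **Dyadic decomposition** (p. 23): if every piece `Σ_f((y₁, y₂])` with
`x₀ ≤ y₁ ≤ y₂ ≤ x`, `y₂ ≤ 2y₁` is bounded by `K y₂`, then `|Σ_f((x₀, x])| ≤ 2Kx` (induction over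
the pieces `(x/2^{j+1}, x/2^j]`, geometric series). [cite: DrappeauTopacogullari2019, §8, p. 23] -/
theorem norm_sigmaF_le_of_dyadic (f : ArithmeticFunction ℂ) (a : ℕ) (h : ℤ) (R : ℝ)
    {x₀ x K : ℝ} (hx₀ : 0 < x₀) (hx : x₀ ≤ x) (hK : 0 ≤ K)
    (hpiece : ∀ y₁ y₂ : ℝ, x₀ ≤ y₁ → y₁ ≤ y₂ → y₂ ≤ x → y₂ ≤ 2 * y₁ →
      ‖sigmaF f y₁ y₂ a h R‖ ≤ K * y₂) :
    ‖sigmaF f x₀ x a h R‖ ≤ 2 * K * x := by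
  have claim : ∀ k : ℕ, ∀ y : ℝ, x₀ ≤ y → y ≤ x → y ≤ 2 ^ k * x₀ →
      ‖sigmaF f x₀ y a h R‖ ≤ 2 * K * y := by
    intro k
    induction k with
    | zero =>
      intro y hy0 hyx hyk
      have : y = x₀ := le_antisymm (by simpa using hyk) hy0
      rw [this, sigmaF_self, norm_zero]
      positivity
    | succ k ih =>
      intro y hy0 hyx hyk
      by_cases hsmall : y ≤ 2 * x₀
      · have := hpiece x₀ y le_rfl hy0 hyx hsmall
        calc ‖sigmaF f x₀ y a h R‖ ≤ K * y := this
          _ ≤ 2 * K * y := by nlinarith [hx₀.le.trans hy0]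
      · push Not at hsmall
        have hy2 : x₀ ≤ y / 2 := by linarith
        rw [sigmaF_add f (y₁ := x₀) (y₂ := y / 2) (y₃ := y) (by linarith) hy2 (by linarith) a h R]
        refine (norm_add_le _ _).trans ?_
        have h1 := ih (y / 2) hy2 (by linarith) (by rw [pow_succ] at hyk; linarith)
        have h2 := hpiece (y / 2) y hy2 (by linarith) hyx (by linarith)
        linarith
  obtain ⟨k, hk⟩ : ∃ k : ℕ, x / x₀ < 2 ^ k := pow_unbounded_of_one_lt _ one_lt_two
  refine claim k x hx le_rfl ?_
  rw [div_lt_iff₀ hx₀] at hk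
  exact hk.le

/-! ### `S = M̃ + E`: inserting `τ = τ̃ + Δ` -/

/-- `∑_{|h|/a < n ≤ x} f(n) τ(an − h) = ∑ f(n) τ̃_h(an; R) + ∑ f(n) Δ_h(an; R)` (definition of
`Δ_h`, p. 9, inside the sum of Theorem 1.2). [cite: DrappeauTopacogullari2019, §2.1 and §8, pp. 9, 23] -/
theorem shiftedSum_eq_dtilde_add_delta (f : ArithmeticFunction ℂ) (x : ℝ) (h : ℤ) (a : ℕ) (R : ℝ) :
    shiftedSum f x h a =
      ∑ n ∈ (Finset.Icc 1 ⌊x⌋₊).filter (fun n : ℕ => h.natAbs < a * n), f n * dtilde h (a * n) R +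
      ∑ n ∈ (Finset.Icc 1 ⌊x⌋₊).filter (fun n : ℕ => h.natAbs < a * n), f n * delta h (a * n) R := by
  rw [shiftedSum, ← Finset.sum_add_distrib]
  refine Finset.sum_congr rfl fun n _ => ?_
  rw [← mul_add, delta, Nat.cast_mul, add_sub_cancel]

/-- Beyond `x₀ ≥ |h|` the constraint `|h| < an` is automatic (`a ≥ 1`), so the `Δ`-part of the
shifted sum over `x₀ < n ≤ x` is exactly `Σ_f((x₀, x]; a, h; R)`.
[cite: DrappeauTopacogullari2019, §8, p. 23] -/
theorem sum_filter_delta_eq_sigmaF (f : ArithmeticFunction ℂ) (x : ℝ) (h : ℤ) {a : ℕ} (ha : 1 ≤ a)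
    (R : ℝ) {x₀ : ℝ} (hh : (h.natAbs : ℝ) ≤ x₀) :
    ∑ n ∈ ((Finset.Icc 1 ⌊x⌋₊).filter (fun n : ℕ => h.natAbs < a * n)).filter
        (fun n : ℕ => x₀ < (n : ℝ)), f n * delta h (a * n) R = sigmaF f x₀ x a h R := by
  unfold sigmaF
  refine Finset.sum_congr ?_ (fun _ _ => rfl)
  ext n
  simp only [Finset.mem_filter, Finset.mem_Icc]
  constructor
  · rintro ⟨⟨h1, -⟩, h2⟩
    exact ⟨h1, h2⟩
  · rintro ⟨h1, h2⟩
    refine ⟨⟨h1, ?_⟩, h2⟩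
    have h3 : (h.natAbs : ℝ) < n := lt_of_le_of_lt hh h2
    have h4 : h.natAbs < n := by exact_mod_cast h3
    calc h.natAbs < n := h4
      _ = 1 * n := (one_mul n).symm
      _ ≤ a * n := Nat.mul_le_mul_right n ha

/-! ### The expanded form of `M̃` with the `q`-sum outside (p. 23) -/

/-- The characters mod `k` of conductor `≤ R` entering (2.1) (a `Finset`; Mathlib's
`DirichletCharacter ℂ k` is a `Fintype`). [cite: DrappeauTopacogullari2019, §2.1 (2.1), p. 9] -/
def charSet (k : ℕ) (R : ℝ) : Finset (DirichletCharacter ℂ k) :=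
  (Finset.univ : Finset (DirichletCharacter ℂ k)).filter (fun χ => (χ.conductor : ℝ) ≤ R)

/-- **The expanded form** `E(Q, S) := 2 ∑_{q ≤ Q} φ(q/(h,q))⁻¹ ∑_{χ mod q/(h,q), cond χ ≤ R}
χ(h/(h,q)) ∑_{n ∈ S(q)} f(n) χ((an/(h,q))⁻¹)` of p. 23 ("After expanding `τ̃_h(an; R)`, it can be
written as `2 ∑_{q ≤ √(ax)} φ(q/(h,q))⁻¹ ∑_{χ mod q/(h,q), cond χ ≤ R} χ̄(h/(h,q))
∑_{q²/a ≤ n ≤ x, (an,q)=(h,q)} f(n) χ(an/(h,q)) + O(x^{δ+ε})`"; here with the conjugate pairing of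
(2.1), `χ(h/(h,q)) χ̄(an/(h,q))`, `χ̄(u) = χ(u⁻¹)`, and a general family of inner sets `S(q)` so that
both the raw swapped sum and the adjusted ranges are instances).
[cite: DrappeauTopacogullari2019, §8, p. 23] -/
def expandedSum (f : ArithmeticFunction ℂ) (h : ℤ) (a : ℕ) (R : ℝ) (Q : ℕ) (S : ℕ → Finset ℕ) : ℂ :=
  2 * ∑ q ∈ Finset.Icc 1 Q,
    ((Nat.totient (q / Nat.gcd h.natAbs q) : ℂ)⁻¹ *
      ∑ χ ∈ charSet (q / Nat.gcd h.natAbs q) R,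
        χ (((h / (Nat.gcd h.natAbs q : ℕ) : ℤ)) : ZMod (q / Nat.gcd h.natAbs q)) *
          ∑ n ∈ S q, f n *
            χ (((a * n / Nat.gcd h.natAbs q : ℕ) : ZMod (q / Nat.gcd h.natAbs q)))⁻¹)

/-- The inner `n`-sets of the RAW swapped sum: `F_q = {n ∈ F : q ≤ √(an − h), (an, q) = (h, q)}`
(the constraints of (2.1) at the argument `an`, read as constraints on `n`).
[cite: DrappeauTopacogullari2019, §8, p. 23] -/
def innerSet (h : ℤ) (a : ℕ) (F : Finset ℕ) (q : ℕ) : Finset ℕ :=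
  F.filter (fun n : ℕ => q ≤ Nat.sqrt (Int.toNat (((a * n : ℕ) : ℤ) - h)) ∧
    Nat.gcd (a * n) q = Nat.gcd h.natAbs q)

/-- **Swapping the `n`- and `q`-sums** (p. 23, "After expanding `τ̃_h(an; R)`"): for any finite
`n`-range `F` whose `q`-ranges lie below `Q`,
`∑_{n ∈ F} f(n) τ̃_h(an; R) = E(Q, q ↦ F_q)`. [cite: DrappeauTopacogullari2019, §8, p. 23] -/
theorem sum_mul_dtilde_eq_expandedSum (f : ArithmeticFunction ℂ) (h : ℤ) (a : ℕ) (R : ℝ)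
    (F : Finset ℕ) {Q : ℕ} (hQ : ∀ n ∈ F, Nat.sqrt (Int.toNat (((a * n : ℕ) : ℤ) - h)) ≤ Q) :
    ∑ n ∈ F, f n * dtilde h (a * n) R = expandedSum f h a R Q (innerSet h a F) := by
  unfold expandedSum innerSet
  have stepA : ∀ n ∈ F, f n * dtilde h (a * n) R =
      ∑ q ∈ Finset.Icc 1 Q,
        (if q ≤ Nat.sqrt (Int.toNat (((a * n : ℕ) : ℤ) - h)) ∧ Nat.gcd (a * n) q = Nat.gcd h.natAbs q
          then f n * (2 * (((Nat.totient (q / Nat.gcd h.natAbs q)) : ℂ)⁻¹ *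
            ∑ χ ∈ charSet (q / Nat.gcd h.natAbs q) R,
              χ (((a * n / Nat.gcd h.natAbs q : ℕ) : ZMod (q / Nat.gcd h.natAbs q)))⁻¹ *
                χ (((h / (Nat.gcd h.natAbs q : ℕ) : ℤ)) : ZMod (q / Nat.gcd h.natAbs q))))
          else 0) := by
    intro n hn
    rw [dtilde, Finset.mul_sum, Finset.mul_sum, ← Finset.sum_filter]
    refine Finset.sum_congr ?_ (fun q _ => rfl)
    ext q
    simp only [Finset.mem_filter, Finset.mem_Icc]
    constructor
    · rintro ⟨⟨hq1, hqs⟩, hg⟩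
      exact ⟨⟨hq1, hqs.trans (hQ n hn)⟩, hqs, hg⟩
    · rintro ⟨⟨hq1, -⟩, hqs, hg⟩
      exact ⟨⟨hq1, hqs⟩, hg⟩
  rw [Finset.sum_congr rfl stepA, Finset.sum_comm, Finset.mul_sum]
  refine Finset.sum_congr rfl fun q _ => ?_
  rw [← Finset.sum_filter]
  simp_rw [Finset.mul_sum]
  refine Finset.sum_comm.trans ?_
  refine Finset.sum_congr rfl fun χ _ => Finset.sum_congr rfl fun n _ => ?_
  ring

/-- `h/(h,q)` is a unit mod `q/(h,q)` (`q ≥ 1`). [folklore] -/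
theorem isUnit_cast_hdiv {h : ℤ} {q : ℕ} (hq : 1 ≤ q) :
    IsUnit ((((h / (Nat.gcd h.natAbs q : ℕ) : ℤ)) : ZMod (q / Nat.gcd h.natAbs q))) := by
  have hd0 : 0 < Nat.gcd h.natAbs q := Nat.gcd_pos_of_pos_right _ hq
  have hdvd : ((Nat.gcd h.natAbs q : ℕ) : ℤ) ∣ h := Int.natCast_dvd.mpr (Nat.gcd_dvd_left _ _)
  rw [ZMod.coe_int_isUnit_iff_isCoprime, Int.isCoprime_iff_gcd_eq_one, Int.gcd_eq_natAbs,
    Int.natAbs_natCast, Int.natAbs_ediv_of_dvd hdvd, Int.natAbs_natCast]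
  exact (Nat.coprime_div_gcd_div_gcd (m := h.natAbs) (n := q) hd0).symm

/-- `an/(h,q)` is a unit mod `q/(h,q)` when `(an, q) = (h, q)`. [folklore] -/
theorem isUnit_cast_andiv {h : ℤ} {q a n : ℕ} (hq : 1 ≤ q)
    (hg : Nat.gcd (a * n) q = Nat.gcd h.natAbs q) :
    IsUnit (((a * n / Nat.gcd h.natAbs q : ℕ) : ZMod (q / Nat.gcd h.natAbs q))) := by
  have hd0 : 0 < Nat.gcd h.natAbs q := Nat.gcd_pos_of_pos_right _ hq
  rw [ZMod.isUnit_iff_coprime]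
  have := Nat.coprime_div_gcd_div_gcd (m := a * n) (n := q) (hg ▸ hd0)
  rwa [hg] at this

/-- … and so is its inverse in `ZMod (q/(h,q))`. [folklore] -/
theorem isUnit_cast_andiv_inv {h : ℤ} {q a n : ℕ} (hq : 1 ≤ q)
    (hg : Nat.gcd (a * n) q = Nat.gcd h.natAbs q) :
    IsUnit (((a * n / Nat.gcd h.natAbs q : ℕ) : ZMod (q / Nat.gcd h.natAbs q)))⁻¹ := by
  have := isUnit_cast_andiv hq hg
  rw [← Int.cast_natCast] at this ⊢
  exact ZMod.isUnit_inv this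

/-- The trivial character has conductor `1 ≤ R`. [folklore] -/
theorem one_mem_charSet {k : ℕ} (hk : 0 < k) {R : ℝ} (hR : 1 ≤ R) :
    (1 : DirichletCharacter ℂ k) ∈ charSet k R := by
  haveI : NeZero k := ⟨hk.ne'⟩
  simp only [charSet, Finset.mem_filter, Finset.mem_univ, true_and,
    DirichletCharacter.conductor_one, Nat.cast_one]
  exact hR

open scoped Classical in
/-- **Principal / non-principal split** (p. 23: "We now split the remaining sum into two parts
… depending on whether `cond(χ) ∣ D` or not. A simple reordering of the sums shows that the first
part is equal to `M_f(x; a, h)`"; at `D = 1` the first part is the trivial character alone): if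
`(an, q) = (h, q)` on `S(q)`, the trivial character contributes `2 ∑_q φ(q/(h,q))⁻¹ ∑_{n ∈ S(q)} f(n)`
exactly (its arguments are units), and the rest is the sum over `χ ≠ 1`, `cond χ ≤ R`.
[cite: DrappeauTopacogullari2019, §8, p. 23] -/
theorem expandedSum_eq_principal_add (f : ArithmeticFunction ℂ) {h : ℤ} (a : ℕ) {R : ℝ}
    (hR : 1 ≤ R) (Q : ℕ) (S : ℕ → Finset ℕ)
    (hS : ∀ q ∈ Finset.Icc 1 Q, ∀ n ∈ S q, Nat.gcd (a * n) q = Nat.gcd h.natAbs q) :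
    expandedSum f h a R Q S =
      2 * ∑ q ∈ Finset.Icc 1 Q, ((Nat.totient (q / Nat.gcd h.natAbs q) : ℂ)⁻¹ * ∑ n ∈ S q, f n) +
      2 * ∑ q ∈ Finset.Icc 1 Q, ((Nat.totient (q / Nat.gcd h.natAbs q) : ℂ)⁻¹ *
        ∑ χ ∈ (charSet (q / Nat.gcd h.natAbs q) R).erase 1,
          χ (((h / (Nat.gcd h.natAbs q : ℕ) : ℤ)) : ZMod (q / Nat.gcd h.natAbs q)) *
            ∑ n ∈ S q, f n *
              χ (((a * n / Nat.gcd h.natAbs q : ℕ) : ZMod (q / Nat.gcd h.natAbs q)))⁻¹) := by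
  unfold expandedSum
  rw [← mul_add, ← Finset.sum_add_distrib]
  congr 1
  refine Finset.sum_congr rfl fun q hq => ?_
  have hq1 : 1 ≤ q := (Finset.mem_Icc.mp hq).1
  have hd0 : 0 < Nat.gcd h.natAbs q := Nat.gcd_pos_of_pos_right _ hq1
  have hk : 0 < q / Nat.gcd h.natAbs q :=
    Nat.div_pos (Nat.le_of_dvd hq1 (Nat.gcd_dvd_right _ _)) hd0
  rw [← mul_add]
  congr 1
  rw [← Finset.add_sum_erase _ _ (one_mem_charSet hk hR)]
  congr 1
  rw [MulChar.one_apply (isUnit_cast_hdiv hq1), one_mul]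
  refine Finset.sum_congr rfl fun n hn => ?_
  rw [MulChar.one_apply (isUnit_cast_andiv_inv hq1 (hS q hq n hn)), mul_one]

/-- With the adjusted ranges `G_q = {n ≤ x : q²/a ≤ n, (an, q) = (h, q)}`, `q ≤ √(ax)`, the
principal part IS `M_f(x; h, a)` (`mainTermOne`), definitionally.
[cite: DrappeauTopacogullari2019, Theorem 1.2 (M_f at D = 1)] -/
theorem mainTermOne_eq (f : ArithmeticFunction ℂ) (x : ℝ) (h : ℤ) (a : ℕ) :
    mainTermOne f x h a = 2 * ∑ q ∈ Finset.Icc 1 ⌊Real.sqrt (a * x)⌋₊,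
      ((Nat.totient (q / Nat.gcd h.natAbs q) : ℂ)⁻¹ *
        ∑ n ∈ (Finset.Icc 1 ⌊x⌋₊).filter
          (fun n : ℕ => (q : ℝ) ^ 2 / a ≤ (n : ℝ) ∧ Nat.gcd (a * n) q = Nat.gcd h.natAbs q), f n) :=
  rfl

/-! ### Comparing expanded forms: the range adjustments cost `O(|h|)` indices per `q` -/

/-- Shrinking the `q`-range of an expanded form when the dropped inner sets are empty. [folklore] -/
theorem expandedSum_eq_of_empty (f : ArithmeticFunction ℂ) (h : ℤ) (a : ℕ) (R : ℝ) {Q Q' : ℕ}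
    (hQ : Q' ≤ Q) (S : ℕ → Finset ℕ) (hS : ∀ q ∈ Finset.Icc 1 Q, Q' < q → S q = ∅) :
    expandedSum f h a R Q S = expandedSum f h a R Q' S := by
  unfold expandedSum
  congr 1
  symm
  refine Finset.sum_subset (fun q hq => ?_) (fun q hq hq' => ?_)
  · simp only [Finset.mem_Icc] at hq ⊢
    exact ⟨hq.1, hq.2.trans hQ⟩
  · have hlt : Q' < q := by
      simp only [Finset.mem_Icc, not_and, not_le] at hq hq'
      exact hq' hq.1
    rw [hS q hq hlt]
    simp

/-- Sums of a `B`-bounded function over two finite sets differ by at most `B` times the size of the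
symmetric difference. [folklore] -/
theorem norm_sum_sub_sum_le {S T : Finset ℕ} {g : ℕ → ℂ} {B : ℝ}
    (hB : ∀ n ∈ S ∪ T, ‖g n‖ ≤ B) :
    ‖∑ n ∈ S, g n - ∑ n ∈ T, g n‖ ≤ B * (((S \ T).card : ℝ) + ((T \ S).card : ℝ)) := by
  classical
  rw [← Finset.sum_inter_add_sum_sdiff S T g, ← Finset.sum_inter_add_sum_sdiff T S g,
    Finset.inter_comm T S, add_sub_add_left_eq_sub]
  refine (norm_sub_le _ _).trans ?_
  rw [mul_add]
  gcongr
  · refine (norm_sum_le _ _).trans ?_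
    refine (Finset.sum_le_sum fun n hn => hB n ?_).trans ?_
    · exact Finset.mem_union_left _ (Finset.mem_sdiff.mp hn).1
    · rw [Finset.sum_const, nsmul_eq_mul, mul_comm]
  · refine (norm_sum_le _ _).trans ?_
    refine (Finset.sum_le_sum fun n hn => hB n ?_).trans ?_
    · exact Finset.mem_union_right _ (Finset.mem_sdiff.mp hn).1
    · rw [Finset.sum_const, nsmul_eq_mul, mul_comm]

/-- **Comparing two expanded forms over the same `q`-range** (the mechanism of the
"`+ O(x^{δ+ε})`" on p. 23): if `|f| ≤ B` on the inner sets and the inner sets differ by at most `M`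
indices for each `q`, then `|E(Q, S) − E(Q, T)| ≤ 2BM ∑_{q ≤ Q} φ(q/(h,q))⁻¹ #{χ : cond χ ≤ R}`
(each character value has norm `≤ 1`). [cite: DrappeauTopacogullari2019, §8, p. 23] -/
theorem norm_expandedSum_sub_le (f : ArithmeticFunction ℂ) (h : ℤ) (a : ℕ) (R : ℝ) (Q : ℕ)
    (S T : ℕ → Finset ℕ) {B M : ℝ} (hB0 : 0 ≤ B)
    (hB : ∀ q ∈ Finset.Icc 1 Q, ∀ n ∈ S q ∪ T q, ‖f n‖ ≤ B)
    (hM : ∀ q ∈ Finset.Icc 1 Q, (((S q \ T q).card : ℝ) + ((T q \ S q).card : ℝ)) ≤ M) :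
    ‖expandedSum f h a R Q S - expandedSum f h a R Q T‖ ≤
      2 * B * M * ∑ q ∈ Finset.Icc 1 Q, ((Nat.totient (q / Nat.gcd h.natAbs q) : ℝ)⁻¹ *
        ((charSet (q / Nat.gcd h.natAbs q) R).card : ℝ)) := by
  unfold expandedSum
  rw [← mul_sub, ← Finset.sum_sub_distrib, norm_mul, Complex.norm_two]
  have key : ∀ q ∈ Finset.Icc 1 Q,
      ‖((Nat.totient (q / Nat.gcd h.natAbs q) : ℂ)⁻¹ *
          ∑ χ ∈ charSet (q / Nat.gcd h.natAbs q) R,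
            χ (((h / (Nat.gcd h.natAbs q : ℕ) : ℤ)) : ZMod (q / Nat.gcd h.natAbs q)) *
              ∑ n ∈ S q, f n *
                χ (((a * n / Nat.gcd h.natAbs q : ℕ) : ZMod (q / Nat.gcd h.natAbs q)))⁻¹) -
        ((Nat.totient (q / Nat.gcd h.natAbs q) : ℂ)⁻¹ *
          ∑ χ ∈ charSet (q / Nat.gcd h.natAbs q) R,
            χ (((h / (Nat.gcd h.natAbs q : ℕ) : ℤ)) : ZMod (q / Nat.gcd h.natAbs q)) *
              ∑ n ∈ T q, f n *
                χ (((a * n / Nat.gcd h.natAbs q : ℕ) : ZMod (q / Nat.gcd h.natAbs q)))⁻¹)‖ ≤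
        B * M * (((Nat.totient (q / Nat.gcd h.natAbs q) : ℝ))⁻¹ *
          ((charSet (q / Nat.gcd h.natAbs q) R).card : ℝ)) := by
    intro q hq
    rw [← mul_sub, ← Finset.sum_sub_distrib, norm_mul, norm_inv, Complex.norm_natCast]
    have hBq : ∀ n ∈ S q ∪ T q, ‖f n‖ ≤ B := hB q hq
    have inner : ∀ χ ∈ charSet (q / Nat.gcd h.natAbs q) R,
        ‖(χ (((h / (Nat.gcd h.natAbs q : ℕ) : ℤ)) : ZMod (q / Nat.gcd h.natAbs q)) *
              ∑ n ∈ S q, f n *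
                χ (((a * n / Nat.gcd h.natAbs q : ℕ) : ZMod (q / Nat.gcd h.natAbs q)))⁻¹) -
            (χ (((h / (Nat.gcd h.natAbs q : ℕ) : ℤ)) : ZMod (q / Nat.gcd h.natAbs q)) *
              ∑ n ∈ T q, f n *
                χ (((a * n / Nat.gcd h.natAbs q : ℕ) : ZMod (q / Nat.gcd h.natAbs q)))⁻¹)‖ ≤
          B * M := by
      intro χ _
      rw [← mul_sub, norm_mul]
      have h1 : ‖χ (((h / (Nat.gcd h.natAbs q : ℕ) : ℤ)) : ZMod (q / Nat.gcd h.natAbs q))‖ ≤ 1 :=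
        DirichletCharacter.norm_le_one χ _
      have h2 := norm_sum_sub_sum_le (S := S q) (T := T q)
        (g := fun n => f n * χ (((a * n / Nat.gcd h.natAbs q : ℕ) :
          ZMod (q / Nat.gcd h.natAbs q)))⁻¹) (B := B) (fun n hn => by
            rw [norm_mul]
            exact (mul_le_of_le_one_right (norm_nonneg _) (DirichletCharacter.norm_le_one χ _)).trans (hBq n hn))
      calc _ ≤ 1 * (B * ((((S q \ T q).card : ℝ) + ((T q \ S q).card : ℝ)))) :=
            mul_le_mul h1 h2 (norm_nonneg _) zero_le_one
        _ ≤ B * M := by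
            rw [one_mul]
            exact mul_le_mul_of_nonneg_left (hM q hq) hB0
    calc _ ≤ ((Nat.totient (q / Nat.gcd h.natAbs q) : ℝ))⁻¹ *
          ∑ χ ∈ charSet (q / Nat.gcd h.natAbs q) R, B * M := by
          refine mul_le_mul_of_nonneg_left ((norm_sum_le _ _).trans (Finset.sum_le_sum inner))
            (inv_nonneg.mpr (Nat.cast_nonneg _))
      _ = B * M * (((Nat.totient (q / Nat.gcd h.natAbs q) : ℝ))⁻¹ *
          ((charSet (q / Nat.gcd h.natAbs q) R).card : ℝ)) := by
          rw [Finset.sum_const, nsmul_eq_mul]; ring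
  refine (mul_le_mul_of_nonneg_left ((norm_sum_le _ _).trans (Finset.sum_le_sum key))
    (by norm_num : (0 : ℝ) ≤ 2)).trans_eq ?_
  rw [← Finset.mul_sum]; ring

/-- Counting: a finite set of `n` whose multiples `an` (`a ≥ 1`) lie in an integer interval
`[L, L + H)` has at most `H` elements (`n ↦ an` is injective). [folklore] -/
theorem card_le_of_mul_mem_Ico (S : Finset ℕ) {a : ℕ} (ha : 0 < a) (L : ℤ) (H : ℕ)
    (hS : ∀ n ∈ S, L ≤ (a : ℤ) * n ∧ (a : ℤ) * n < L + H) : S.card ≤ H := by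
  have hinj : Set.InjOn (fun n : ℕ => (a : ℤ) * n) S := by
    intro n₁ _ n₂ _ heq
    have ha' : (a : ℤ) ≠ 0 := by exact_mod_cast ha.ne'
    have := mul_left_cancel₀ ha' heq
    exact_mod_cast this
  have hmaps : Set.MapsTo (fun n : ℕ => (a : ℤ) * n) S (Finset.Ico L (L + H)) := by
    intro n hn
    simp only [Finset.coe_Ico, Set.mem_Ico]
    exact hS n hn
  calc S.card ≤ (Finset.Ico L (L + H)).card := Finset.card_le_card_of_injOn _ hmaps hinj
    _ = H := by rw [Int.card_Ico]; simp

/-- Membership in the raw inner set `F_q` over the `n`-range of Theorem 1.2, in integers: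
`1 ≤ n ≤ ⌊x⌋`, `|h| < an`, `q² ≤ an − h`, `(an, q) = (h, q)`. [folklore] -/
theorem mem_innerSet_iff (x : ℝ) (h : ℤ) (a q n : ℕ) :
    n ∈ innerSet h a ((Finset.Icc 1 ⌊x⌋₊).filter (fun n : ℕ => h.natAbs < a * n)) q ↔
      (1 ≤ n ∧ n ≤ ⌊x⌋₊) ∧ (h.natAbs : ℤ) < (a : ℤ) * n ∧ ((q * q : ℕ) : ℤ) ≤ (a : ℤ) * n - h ∧
        Nat.gcd (a * n) q = Nat.gcd h.natAbs q := by
  simp only [innerSet, Finset.mem_filter, Finset.mem_Icc, Nat.le_sqrt]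
  constructor
  · rintro ⟨⟨hn, hh⟩, hq, hg⟩
    have hh' : (h.natAbs : ℤ) < (a : ℤ) * n := by exact_mod_cast hh
    have hpos : (0 : ℤ) ≤ (a : ℤ) * n - h := by
      have : h ≤ (h.natAbs : ℤ) := Int.le_natAbs; linarith
    refine ⟨hn, hh', ?_, hg⟩
    have : ((Int.toNat (((a * n : ℕ) : ℤ) - h) : ℕ) : ℤ) = (a : ℤ) * n - h := by
      rw [Int.toNat_of_nonneg (by push_cast; exact hpos)]; push_cast; ring
    calc ((q * q : ℕ) : ℤ) ≤ ((Int.toNat (((a * n : ℕ) : ℤ) - h) : ℕ) : ℤ) := by exact_mod_cast hq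
      _ = _ := this
  · rintro ⟨hn, hh, hq, hg⟩
    have hh' : h.natAbs < a * n := by exact_mod_cast hh
    refine ⟨⟨hn, hh'⟩, ?_, hg⟩
    have hpos : (0 : ℤ) ≤ (a : ℤ) * n - h := by
      have : h ≤ (h.natAbs : ℤ) := Int.le_natAbs; linarith
    have : ((Int.toNat (((a * n : ℕ) : ℤ) - h) : ℕ) : ℤ) = (a : ℤ) * n - h := by
      rw [Int.toNat_of_nonneg (by push_cast; exact hpos)]; push_cast; ring
    have : ((q * q : ℕ) : ℤ) ≤ ((Int.toNat (((a * n : ℕ) : ℤ) - h) : ℕ) : ℤ) := by rw [this]; exact hq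
    exact_mod_cast this

/-- Membership in the adjusted inner set `G_q`, in integers: `1 ≤ n ≤ ⌊x⌋`, `q² ≤ an`,
`(an, q) = (h, q)`. [folklore] -/
theorem mem_mainSet_iff (x : ℝ) (h : ℤ) {a : ℕ} (ha : 0 < a) (q n : ℕ) :
    n ∈ (Finset.Icc 1 ⌊x⌋₊).filter
        (fun n : ℕ => (q : ℝ) ^ 2 / a ≤ (n : ℝ) ∧ Nat.gcd (a * n) q = Nat.gcd h.natAbs q) ↔
      (1 ≤ n ∧ n ≤ ⌊x⌋₊) ∧ ((q * q : ℕ) : ℤ) ≤ (a : ℤ) * n ∧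
        Nat.gcd (a * n) q = Nat.gcd h.natAbs q := by
  simp only [Finset.mem_filter, Finset.mem_Icc]
  have ha' : (0 : ℝ) < a := by exact_mod_cast ha
  have key : (q : ℝ) ^ 2 / a ≤ (n : ℝ) ↔ ((q * q : ℕ) : ℤ) ≤ (a : ℤ) * n := by
    rw [div_le_iff₀ ha']
    constructor
    · intro hle
      have : ((q * q : ℕ) : ℝ) ≤ ((a * n : ℕ) : ℝ) := by push_cast; nlinarith
      exact_mod_cast this
    · intro hle
      have : ((q * q : ℕ) : ℝ) ≤ ((a * n : ℕ) : ℝ) := by exact_mod_cast hle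
      push_cast at this; nlinarith
  rw [key]

/-- **Per-`q` count of the range adjustments** (p. 23, "`+ O(x^{δ+ε})`"): between the raw inner
set `F_q` and the adjusted `G_q` (for `q ≤ Q₁ = ⌊√(ax)⌋`; `∅` beyond, where `F_q` alone is
counted) at most `2|h|` indices `n` differ, since on each one-sided difference `an` lies in an
integer interval of length `|h|`. [cite: DrappeauTopacogullari2019, §8, p. 23] -/
theorem card_sdiff_add_card_sdiff_le (x : ℝ) {h : ℤ} {a : ℕ} (ha : 0 < a) {q : ℕ} (hq : 1 ≤ q)
    (Q₁ : ℕ) (hQ₁ : a * ⌊x⌋₊ < (Q₁ + 1) * (Q₁ + 1)) :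
    (((innerSet h a ((Finset.Icc 1 ⌊x⌋₊).filter (fun n : ℕ => h.natAbs < a * n)) q) \
        (if q ≤ Q₁ then (Finset.Icc 1 ⌊x⌋₊).filter
          (fun n : ℕ => (q : ℝ) ^ 2 / a ≤ (n : ℝ) ∧ Nat.gcd (a * n) q = Nat.gcd h.natAbs q) else ∅)).card : ℝ) +
      ((((if q ≤ Q₁ then (Finset.Icc 1 ⌊x⌋₊).filter
          (fun n : ℕ => (q : ℝ) ^ 2 / a ≤ (n : ℝ) ∧ Nat.gcd (a * n) q = Nat.gcd h.natAbs q) else ∅) \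
        (innerSet h a ((Finset.Icc 1 ⌊x⌋₊).filter (fun n : ℕ => h.natAbs < a * n)) q)).card : ℝ))
      ≤ 2 * |(h : ℝ)| := by
  have habs : ((h.natAbs : ℕ) : ℝ) = |(h : ℝ)| := by rw [Nat.cast_natAbs, Int.cast_abs]
  have habsZ : ((h.natAbs : ℕ) : ℤ) = |h| := Nat.cast_natAbs h
  -- first difference: an ∈ [q² + h, q² + h + |h|)
  have h1 : (innerSet h a ((Finset.Icc 1 ⌊x⌋₊).filter (fun n : ℕ => h.natAbs < a * n)) q \
        (if q ≤ Q₁ then (Finset.Icc 1 ⌊x⌋₊).filter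
          (fun n : ℕ => (q : ℝ) ^ 2 / a ≤ (n : ℝ) ∧ Nat.gcd (a * n) q = Nat.gcd h.natAbs q) else ∅)).card
      ≤ h.natAbs := by
    refine card_le_of_mul_mem_Ico _ ha (((q * q : ℕ) : ℤ) + h) h.natAbs fun n hn => ?_
    rw [Finset.mem_sdiff, mem_innerSet_iff] at hn
    obtain ⟨⟨hnx, hhn, hqn, hg⟩, hnot⟩ := hn
    refine ⟨by linarith, ?_⟩
    split_ifs at hnot with hqQ
    · rw [mem_mainSet_iff x h ha] at hnot
      have : ¬ (((q * q : ℕ) : ℤ) ≤ (a : ℤ) * n) := fun hle => hnot ⟨hnx, hle, hg⟩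
      push Not at this
      rw [habsZ]; linarith [neg_abs_le h]
    · -- q > Q₁: an ≤ a⌊x⌋ < (Q₁+1)² ≤ q²
      push Not at hqQ
      have h2 : (a : ℤ) * n ≤ (a : ℤ) * ⌊x⌋₊ := by exact_mod_cast Nat.mul_le_mul_left a hnx.2
      have h3 : ((a * ⌊x⌋₊ : ℕ) : ℤ) < (((Q₁ + 1) * (Q₁ + 1) : ℕ) : ℤ) := by exact_mod_cast hQ₁
      have h4 : (Q₁ + 1) * (Q₁ + 1) ≤ q * q := Nat.mul_le_mul hqQ hqQ
      have h4' : (((Q₁ + 1) * (Q₁ + 1) : ℕ) : ℤ) ≤ ((q * q : ℕ) : ℤ) := by exact_mod_cast h4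
      push_cast at h2 h3 h4' ⊢
      linarith [neg_abs_le h]
  have h2 : ((if q ≤ Q₁ then (Finset.Icc 1 ⌊x⌋₊).filter
          (fun n : ℕ => (q : ℝ) ^ 2 / a ≤ (n : ℝ) ∧ Nat.gcd (a * n) q = Nat.gcd h.natAbs q) else ∅) \
        innerSet h a ((Finset.Icc 1 ⌊x⌋₊).filter (fun n : ℕ => h.natAbs < a * n)) q).card
      ≤ h.natAbs := by
    split_ifs with hqQ
    · refine card_le_of_mul_mem_Ico _ ha ((q * q : ℕ) : ℤ) h.natAbs fun n hn => ?_
      rw [Finset.mem_sdiff, mem_mainSet_iff x h ha, mem_innerSet_iff] at hn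
      obtain ⟨⟨hnx, hqn, hg⟩, hnot⟩ := hn
      refine ⟨hqn, ?_⟩
      by_cases hh : (h.natAbs : ℤ) < (a : ℤ) * n
      · have : ¬ (((q * q : ℕ) : ℤ) ≤ (a : ℤ) * n - h) := fun hle => hnot ⟨hnx, hh, hle, hg⟩
        push Not at this
        have hle : h ≤ |h| := le_abs_self h
        rw [habsZ]; linarith
      · push Not at hh
        have hq1 : (1 : ℤ) ≤ ((q * q : ℕ) : ℤ) := by exact_mod_cast Nat.mul_le_mul hq hq
        rw [habsZ] at hh ⊢; linarith
    · simp
  have e1 := (Nat.cast_le (α := ℝ)).mpr h1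
  have e2 := (Nat.cast_le (α := ℝ)).mpr h2
  rw [← habs]
  linarith

/-- Expanded forms agree when the inner sets agree on `1 ≤ q ≤ Q`. [folklore] -/
theorem expandedSum_congr (f : ArithmeticFunction ℂ) (h : ℤ) (a : ℕ) (R : ℝ) (Q : ℕ)
    {S T : ℕ → Finset ℕ} (hST : ∀ q ∈ Finset.Icc 1 Q, S q = T q) :
    expandedSum f h a R Q S = expandedSum f h a R Q T := by
  unfold expandedSum
  congr 1
  refine Finset.sum_congr rfl fun q hq => ?_
  rw [hST q hq]

/-- The `q`-ranges of `τ̃_h(an; R)`, `n ≤ x`, all lie below `Q_max = ⌊√(a⌊x⌋ + |h|)⌋`. [folklore] -/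
theorem sqrt_toNat_le (x : ℝ) (h : ℤ) (a : ℕ) {n : ℕ} (hn : n ≤ ⌊x⌋₊) :
    Nat.sqrt (Int.toNat (((a * n : ℕ) : ℤ) - h)) ≤ Nat.sqrt (a * ⌊x⌋₊ + h.natAbs) := by
  refine Nat.sqrt_le_sqrt ?_
  have h1 : Int.toNat (((a * n : ℕ) : ℤ) - h) ≤ a * n + h.natAbs := by
    refine Int.toNat_le.mpr ?_
    have : -h ≤ |h| := neg_le_abs h
    push_cast; linarith
  exact h1.trans (Nat.add_le_add_right (Nat.mul_le_mul_left a hn) _)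

/-- `∑_{q ≤ Q} 1/q ≤ 1 + log Q` (Mathlib's `harmonic_le_one_add_log`; private copy). [folklore] -/
private theorem harmonic_Icc_le' (Q : ℕ) : ∑ q ∈ Finset.Icc 1 Q, ((q : ℝ))⁻¹ ≤ 1 + Real.log Q := by
  have := harmonic_le_one_add_log Q
  rw [harmonic_eq_sum_Icc] at this
  push_cast at this
  exact this

/-- **The weights of the expanded form**: `∑_{q ≤ Q} φ(q/(h,q))⁻¹ #{χ mod q/(h,q) : cond χ ≤ R}
≤ R |h| T² (1 + log Q)` when `τ ≤ T` on `[1, Q]` and `h ≠ 0` (as in the trivial bound (2.2):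
`#{χ} ≤ R τ(k)`, `φ(k)⁻¹ ≤ τ(k)/k`, `1/k = (h,q)/q ≤ |h|/q`, harmonic sum).
[cite: DrappeauTopacogullari2019, §2.1 (2.2), p. 9] -/
theorem sum_totient_inv_mul_card_charSet_le {h : ℤ} (hh : h ≠ 0) {R T : ℝ} (hR : 0 ≤ R) (Q : ℕ)
    (hT : ∀ q ∈ Finset.Icc 1 Q, ((Nat.divisors q).card : ℝ) ≤ T) :
    ∑ q ∈ Finset.Icc 1 Q, ((Nat.totient (q / Nat.gcd h.natAbs q) : ℝ)⁻¹ *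
        ((charSet (q / Nat.gcd h.natAbs q) R).card : ℝ)) ≤
      R * (|(h : ℝ)| * T ^ 2 * (1 + Real.log Q)) := by
  have hhpos : 0 < h.natAbs := Int.natAbs_pos.mpr hh
  have habs : ((h.natAbs : ℕ) : ℝ) = |(h : ℝ)| := by
    rw [Nat.cast_natAbs, Int.cast_abs]
  have key : ∀ q ∈ Finset.Icc 1 Q,
      ((Nat.totient (q / Nat.gcd h.natAbs q) : ℝ))⁻¹ *
        ((charSet (q / Nat.gcd h.natAbs q) R).card : ℝ) ≤ R * (|(h : ℝ)| * T ^ 2 * ((q : ℝ))⁻¹) := by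
    intro q hq
    have hq1 : 1 ≤ q := (Finset.mem_Icc.mp hq).1
    have hq0 : (0 : ℝ) < q := by exact_mod_cast hq1
    set d := Nat.gcd h.natAbs q with hd
    have hd0 : 0 < d := Nat.gcd_pos_of_pos_right _ hq1
    have hdq : d ∣ q := Nat.gcd_dvd_right _ _
    have hdh : d ≤ h.natAbs := Nat.gcd_le_left _ hhpos
    set k := q / d with hk
    have hk0 : 0 < k := Nat.div_pos (Nat.le_of_dvd hq1 hdq) hd0
    have hkq : k ∣ q := Nat.div_dvd_of_dvd hdq
    have hτk : ((Nat.divisors k).card : ℝ) ≤ T := by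
      refine le_trans ?_ (hT q hq)
      exact_mod_cast Finset.card_le_card (Nat.divisors_subset_of_dvd (by omega) hkq)
    have hτk0 : (0 : ℝ) ≤ (Nat.divisors k).card := Nat.cast_nonneg _
    have hT0 : 0 ≤ T := hτk0.trans hτk
    have hkinv : ((k : ℝ))⁻¹ ≤ |(h : ℝ)| * ((q : ℝ))⁻¹ := by
      have hkd : (k : ℝ) * d = q := by
        rw [hk]; exact_mod_cast Nat.div_mul_cancel hdq
      have hd0' : (0 : ℝ) < d := by exact_mod_cast hd0
      have h1 : (1 : ℝ) ≤ |(h : ℝ)| * ((d : ℝ))⁻¹ := by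
        rw [← div_eq_mul_inv, one_le_div hd0', ← habs]; exact_mod_cast hdh
      rw [← hkd]
      calc ((k : ℝ))⁻¹ = 1 * ((k : ℝ))⁻¹ := (one_mul _).symm
        _ ≤ (|(h : ℝ)| * ((d : ℝ))⁻¹) * ((k : ℝ))⁻¹ :=
            mul_le_mul_of_nonneg_right h1 (by positivity)
        _ = |(h : ℝ)| * ((k : ℝ) * (d : ℝ))⁻¹ := by rw [mul_inv]; ring
    have hN : ((charSet k R).card : ℝ) ≤ R * (Nat.divisors k).card := card_filter_conductor_le hk0 hR
    calc ((Nat.totient k : ℝ))⁻¹ * ((charSet k R).card : ℝ)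
        ≤ (((Nat.divisors k).card : ℝ) / k) * (R * (Nat.divisors k).card) :=
          mul_le_mul (totient_inv_le k hk0) hN (Nat.cast_nonneg _) (by positivity)
      _ = R * (((Nat.divisors k).card : ℝ) ^ 2 * ((k : ℝ))⁻¹) := by ring
      _ ≤ R * (T ^ 2 * (|(h : ℝ)| * ((q : ℝ))⁻¹)) := by
          refine mul_le_mul_of_nonneg_left ?_ hR
          exact mul_le_mul (pow_le_pow_left₀ hτk0 hτk 2) hkinv (by positivity) (by positivity)
      _ = R * (|(h : ℝ)| * T ^ 2 * ((q : ℝ))⁻¹) := by ring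
  refine (Finset.sum_le_sum key).trans ?_
  rw [← Finset.mul_sum, ← Finset.mul_sum]
  refine mul_le_mul_of_nonneg_left ?_ hR
  exact mul_le_mul_of_nonneg_left (harmonic_Icc_le' Q) (by
    have : (0 : ℝ) ≤ T ^ 2 := sq_nonneg T
    positivity)

open scoped Classical in
/-- **§8, the main-term bookkeeping (p. 23): `M̃ = M_f(x; h, a) + M⁽²⁾ + O(R x^{2δ+ε})`.**
Swapping the sums in `M̃ = ∑_{|h|/a < n ≤ x} f(n) τ̃_h(an; R)`, adjusting the ranges to
`q ≤ √(ax)`, `q²/a ≤ n ≤ x` at the cost of `≤ 2|h|` indices per `q`, and splitting off the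
principal character, which gives `M_f(x; h, a)` exactly; the rest is the non-principal sum
`M⁽²⁾` (second display of p. 23 at `D = 1`). [cite: DrappeauTopacogullari2019, §8, p. 23] -/
theorem norm_mtilde_sub_mainTermOne_sub_nonprincipal_le (f : ArithmeticFunction ℂ) {x : ℝ}
    (hx : 0 ≤ x) {h : ℤ} (hh : h ≠ 0) {a : ℕ} (ha : 1 ≤ a) {R : ℝ} (hR : 1 ≤ R) {B T : ℝ}
    (hB0 : 0 ≤ B) (hB : ∀ n ∈ Finset.Icc 1 ⌊x⌋₊, ‖f n‖ ≤ B)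
    (hT : ∀ q ∈ Finset.Icc 1 (max (Nat.sqrt (a * ⌊x⌋₊ + h.natAbs)) ⌊Real.sqrt (a * x)⌋₊),
      ((Nat.divisors q).card : ℝ) ≤ T) :
    ‖∑ n ∈ (Finset.Icc 1 ⌊x⌋₊).filter (fun n : ℕ => h.natAbs < a * n), f n * dtilde h (a * n) R
        - mainTermOne f x h a
        - 2 * ∑ q ∈ Finset.Icc 1 ⌊Real.sqrt (a * x)⌋₊,
            ((Nat.totient (q / Nat.gcd h.natAbs q) : ℂ)⁻¹ *
              ∑ χ ∈ (charSet (q / Nat.gcd h.natAbs q) R).erase 1,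
                χ (((h / (Nat.gcd h.natAbs q : ℕ) : ℤ)) : ZMod (q / Nat.gcd h.natAbs q)) *
                  ∑ n ∈ (Finset.Icc 1 ⌊x⌋₊).filter
                      (fun n : ℕ => (q : ℝ) ^ 2 / a ≤ (n : ℝ) ∧
                        Nat.gcd (a * n) q = Nat.gcd h.natAbs q),
                    f n * χ (((a * n / Nat.gcd h.natAbs q : ℕ) :
                      ZMod (q / Nat.gcd h.natAbs q)))⁻¹)‖ ≤
      4 * B * |(h : ℝ)| * (R * (|(h : ℝ)| * T ^ 2 *
        (1 + Real.log (max (Nat.sqrt (a * ⌊x⌋₊ + h.natAbs)) ⌊Real.sqrt (a * x)⌋₊ : ℕ)))) := by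
  have ha0 : 0 < a := ha
  set F := (Finset.Icc 1 ⌊x⌋₊).filter (fun n : ℕ => h.natAbs < a * n) with hF
  set Qmax := Nat.sqrt (a * ⌊x⌋₊ + h.natAbs) with hQmax
  set Q₁ := ⌊Real.sqrt (a * x)⌋₊ with hQ₁
  set Q := max Qmax Q₁ with hQ
  set G : ℕ → Finset ℕ := (fun q : ℕ => (Finset.Icc 1 ⌊x⌋₊).filter
          (fun n : ℕ => (q : ℝ) ^ 2 / a ≤ (n : ℝ) ∧ Nat.gcd (a * n) q = Nat.gcd h.natAbs q)) with hG
  set G' : ℕ → Finset ℕ := fun q => if q ≤ Q₁ then G q else ∅ with hG'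
  -- (1) swap
  have h_swap : ∑ n ∈ F, f n * dtilde h (a * n) R = expandedSum f h a R Qmax (innerSet h a F) :=
    sum_mul_dtilde_eq_expandedSum f h a R F fun n hn => by
      have hn' : n ≤ ⌊x⌋₊ := (Finset.mem_Icc.mp (Finset.mem_filter.mp hn).1).2
      exact sqrt_toNat_le x h a hn'
  -- (2) enlarge the q-range to Q
  have h_up : expandedSum f h a R Q (innerSet h a F) = expandedSum f h a R Qmax (innerSet h a F) := by
    refine expandedSum_eq_of_empty f h a R (le_max_left _ _) _ fun q hq hlt => ?_
    rw [Finset.eq_empty_iff_forall_notMem]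
    intro n hn
    simp only [innerSet, Finset.mem_filter] at hn
    have hn' : n ≤ ⌊x⌋₊ := (Finset.mem_Icc.mp (Finset.mem_filter.mp hn.1).1).2
    have := (hn.2.1.trans (sqrt_toNat_le x h a hn'))
    omega
  -- (3) the comparison form over q ≤ Q₁
  have h_G1 : expandedSum f h a R Q G' = expandedSum f h a R Q₁ G := by
    rw [expandedSum_eq_of_empty f h a R (le_max_right _ _) G' fun q hq hlt => by
      simp only [hG', if_neg (not_le.mpr hlt)]]
    exact expandedSum_congr f h a R Q₁ fun q hq => by
      simp only [hG', if_pos (Finset.mem_Icc.mp hq).2]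
  -- (4) principal part
  have h_split := expandedSum_eq_principal_add f a hR Q₁ G fun q hq n hn => by
    simp only [hG, Finset.mem_filter] at hn
    exact hn.2.2
  have h_main : mainTermOne f x h a = 2 * ∑ q ∈ Finset.Icc 1 Q₁,
      ((Nat.totient (q / Nat.gcd h.natAbs q) : ℂ)⁻¹ * ∑ n ∈ G q, f n) := mainTermOne_eq f x h a
  -- (5) rewrite the quantity to bound as a difference of expanded forms
  have h_eq : ∑ n ∈ F, f n * dtilde h (a * n) R - mainTermOne f x h a -
      2 * ∑ q ∈ Finset.Icc 1 Q₁, ((Nat.totient (q / Nat.gcd h.natAbs q) : ℂ)⁻¹ *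
        ∑ χ ∈ (charSet (q / Nat.gcd h.natAbs q) R).erase 1,
          χ (((h / (Nat.gcd h.natAbs q : ℕ) : ℤ)) : ZMod (q / Nat.gcd h.natAbs q)) *
            ∑ n ∈ G q, f n * χ (((a * n / Nat.gcd h.natAbs q : ℕ) :
              ZMod (q / Nat.gcd h.natAbs q)))⁻¹) =
      expandedSum f h a R Q (innerSet h a F) - expandedSum f h a R Q G' := by
    rw [h_swap, ← h_up, h_G1, h_split, h_main]; ring
  rw [h_eq]
  -- (6) the comparison bound
  have hQ₁lt : a * ⌊x⌋₊ < (Q₁ + 1) * (Q₁ + 1) := by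
    have h1 : Real.sqrt (a * x) < (Q₁ : ℝ) + 1 := Nat.lt_floor_add_one _
    have h2 : (a : ℝ) * ⌊x⌋₊ ≤ a * x := by
      refine mul_le_mul_of_nonneg_left (Nat.floor_le hx) (by positivity)
    have h3 : (a : ℝ) * x < ((Q₁ : ℝ) + 1) ^ 2 := by
      have hs : 0 ≤ Real.sqrt (a * x) := Real.sqrt_nonneg _
      have := Real.sq_sqrt (show (0 : ℝ) ≤ a * x by positivity)
      nlinarith
    have h4 : ((a * ⌊x⌋₊ : ℕ) : ℝ) < (((Q₁ + 1) * (Q₁ + 1) : ℕ) : ℝ) := by push_cast; nlinarith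
    exact_mod_cast h4
  have h_cmp := norm_expandedSum_sub_le f h a R Q (innerSet h a F) G' (B := B) (M := 2 * |(h : ℝ)|)
    hB0 (fun q hq n hn => ?_) (fun q hq => ?_)
  rotate_left
  · -- norm bound on the union
    refine hB n ?_
    rcases Finset.mem_union.mp hn with hn | hn
    · exact (Finset.mem_filter.mp (Finset.mem_filter.mp hn).1).1
    · simp only [hG'] at hn
      split_ifs at hn with hq1
      · exact (Finset.mem_filter.mp hn).1
      · simp at hn
  · exact card_sdiff_add_card_sdiff_le x ha0 (Finset.mem_Icc.mp hq).1 Q₁ hQ₁lt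
  refine h_cmp.trans ?_
  have h_w := sum_totient_inv_mul_card_charSet_le hh (zero_le_one.trans hR) Q hT
  have habs : (0 : ℝ) ≤ |(h : ℝ)| := abs_nonneg _
  calc 2 * B * (2 * |(h : ℝ)|) * _ ≤ 2 * B * (2 * |(h : ℝ)|) * (R * (|(h : ℝ)| * T ^ 2 *
        (1 + Real.log (Q : ℕ)))) := by
        refine mul_le_mul_of_nonneg_left h_w (by positivity)
    _ = _ := by rw [hQ]; ring

end DrappeauTopacogullari2019

end Literature.NumberTheory.Sieve

end
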